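import Summits.QuantumFields.BalabanUV.Beta.GAN24.RespGaugeStencil
import Summits.QuantumFields.BalabanUV.Beta.GAN24.RespKernelColumnCharge
import Summits.QuantumFields.BalabanUV.Beta.GAN24.EEWordReduced
import Summits.QuantumFields.BalabanUV.Beta.DecayingKernelNeumann

/-!
# `BalabanUV.Beta.GAN24.RespInnerBondKernel` — binder row G-an2-4 ∕ (CONV-C), W-slot CT-W, conservation law (C)∕(C)sym, step (L3c)(v) of this lineage's note
# `HOME/b2b-balaban-gan24-formalise-leaf-04/g66/CSYM-LEVEL0-KERNEL-BLUEPRINT.md` §8: **THE DERIVATIVE OF THE INVERSE SUMMED OVER ITS BOND IS THE GAUGE-DIFFERENTIATED INVERSE**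
# `Σ'_{c′} K2OfK X̃♮_j Lc S M μ c′ = 𝒦_μ := −(X̃♮_j ∘ 𝒮_μ) ∘ X̃♮_j`, `𝒮_μ = Lc·s_m s_f·σ_j·Σ'_t 𝟙f(t_μ)·S μ t` (pointwise `HasSum`), a DECAYING, BLOCK-COVARIANT kernel, whose
# coarse column charges against `inr ν` are `−Σ'_{s′} Σ_b (X̃♮_j ∘ 𝒮_μ)(t, s′)(g, b)·chg_ν(b, s′)`

NOT IN PRINT; OUR BOOKKEEPING ([folklore] tsum bookkeeping over TREE objects BY NAME: an2's `SecondOrderResponse.K2OfK ∕ dM ∕ vertexFamily_dM`, an5∕an4's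
`ExpKernelCalculus.comp ∕ biLoc_comp_decays ∕ comp_shiftK`, `DecayingKernelNeumann.decays_comp_mixed`, this lineage's 35 `RespGaugeStencil.hasSum_dM_dressedStep_bond ∕ decays_faceStencil ∕
shiftK_faceStencil`, 34 `RespKernelColumnCharge.hasSum_neg_comp_col_site`, 15 `EEWordReduced.shiftK_dressedStep`, 4 `DressedStepFaceCharges.hasSum_dressedStep_col`, leaf-06's
`DMBondCharges.hasSum_fibre_swap`, `ResolventLegCharges.summable_exp_coarse' ∕ tsum_exp_coarse_le'`; G-an2-4 formalisation swarm, leaf prover `b2b-balaban-gan24-formalise-leaf-04`, gen 67).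
HONEST FRAMING (cell contract, verbatim): «discharging `BetaPertH` makes Bałaban's UV stability UNCONDITIONAL — a real constructive-QFT result; it is NOT the continuum limit and NOT
the Clay problem.»  HONEST DEPENDENCY (verbatim): «continuum YM on T⁴ ⇐ BetaPertH ∧ nine spine estimates (0/9 proved); BetaPertH ⇐ (D1) ∧ (D4) ∧ CAP+tail; G-an2-4 gates asym, D1
and NE2/3/4.»

WHY (blueprint §8 (L3c); journal [LEAF04-G67-INTENT35]): the lattice sum of the outer-summed response word, moved onto the inner bond by joint covariance, is the two-face word of
`dM (Σ'_{c′} K2_{μc′}) …`; this file identifies the summed kernel with `𝒦_μ = −(X̃ ∘ 𝒮_μ) ∘ X̃` (two nested one-sided Fubinis over the bond index inside the two compositions), records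
that `𝒦_μ` is a decaying block-covariant kernel (so `SlotColumnTwoFaceWord` §2 applies to it) and computes its column charges against a coarse multiplier leg through the exit-face
charges of the right factor `X̃` (`RespKernelColumnCharge.hasSum_neg_comp_col_site`).

WHAT ([folklore]; generic `d`; in-block root, `1 ≤ Lc`, every `j`, all units; `S` `LocStencil` ∕ `M` `VertexFamily` at positive rates; 0 `def`, 0 cited facts, 0 `def … : Prop`, 0 sorry):
§1 the scaled gauge stencil `𝒮_μ x z a b := Lc·s_m s_f·σ_j · Σ'_t [t_μ % Lc = Lc−1]·S μ t x z a b`: `decays_gaugeStencil`, `shiftK_gaugeStencil`, `exists_decays_comp_dressedStep_gaugeStencil`,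
`summable_row_comp_dressedStep_gaugeStencil`.
§2 GENERIC (any decaying `K`, any family `V c′` bi-localised at `N•c′` with one constant and pointwise bond sum `W`): **`hasSum_comp_family_bond`** (`HasSum (c′ ↦ (K ∘ V c′) x s′ a g′)
((K ∘ W) x s′ a g′)`), **`hasSum_comp_comp_family_bond`** (`HasSum (c′ ↦ ((K ∘ V c′) ∘ K) x z a b) (((K ∘ W) ∘ K) x z a b)`); §2b **`hasSum_K2OfK_dressedStep_bond`**
(`HasSum (c′ ↦ K2OfK X̃ Lc S M μ c′ x z a b) (−((X̃ ∘ 𝒮_μ) ∘ X̃) x z a b)`).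
§3 `exists_decays_respKernel` (`𝒦_μ` decays), **`shiftK_respKernel`** (block covariance), **`hasSum_respKernel_col`** (its column charges against `inr ν`).
Asserts NO value of Bałaban's tables; discharges NOTHING of (C)sym ∕ (Q-D) ∕ (Q-D-rate) ∕ «T2Shape» ∕ «T2Drift» ∕ (hW, hWall); NEVER «G-an2-4 closed» as (CONV-C); NOT D1, NOT
`BetaPertH`, NOT continuum, NOT Clay.  2026-08-23; no existing file touched.
-/

noncomputable section

open Finset
open scoped BigOperators
open Literature.MathematicalPhysics.QuantumFieldTheory
open Literature.MathematicalPhysics.QuantumFieldTheory.Balaban1983to89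
open Literature.MathematicalPhysics.QuantumFieldTheory.Balaban1983to89.Beta
open AffineAveraging (Site box toSite)
open B12Sec2to5 (l1 l1_nonneg)
open ExpKernelCalculus (MKer comp Decays BiLoc VertexFamily Zl Zl_nonneg shiftK comp_shiftK biLoc_comp_decays summable_exp_shift summable_exp_shift' tsum_exp_shift' l1_sub_triangle)
open OneStepResolventKernel (Fib LocStencil decays_mono biLoc_mono)
open OneStepKernelFamily (KInvStep decays_KInvStep)
open BalabanStepJets (locStencil_mono)
open SecondOrderResponse (dM K2OfK vertexFamily_dM)
open Summit.QuantumFields.BalabanUV.Beta.HessKerDressedUnits (unitK decays_unitK)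
open Summit.QuantumFields.BalabanUV.Beta.AxialDressingRooted (coDressKBmAt decays_coDressKBmAt)
open Summit.QuantumFields.BalabanUV.Beta.DecayingKernelNeumann (decays_comp_mixed)
open Summit.QuantumFields.BalabanUV.Beta.GAN24.DMBondCharges (hasSum_fibre_swap)
open Summit.QuantumFields.BalabanUV.Beta.GAN24.ResolventLegCharges (summable_exp_coarse' tsum_exp_coarse_le')
open Summit.QuantumFields.BalabanUV.Beta.GAN24.EEWordReduced (shiftK_dressedStep)
open Summit.QuantumFields.BalabanUV.Beta.GAN24.DressedStepFaceCharges (hasSum_dressedStep_col)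
open Summit.QuantumFields.BalabanUV.Beta.GAN24.RespKernelColumnCharge (hasSum_neg_comp_col_site)
open Summit.QuantumFields.BalabanUV.Beta.GAN24.RespGaugeStencil (hasSum_dM_dressedStep_bond decays_faceStencil shiftK_faceStencil)

namespace Summit.QuantumFields.BalabanUV.Beta.GAN24.RespInnerBondKernel

variable {d : ℕ} {Lc : ℕ} [NeZero Lc] {r : Fin (d + 1) → ℕ} {S M : Fin (d + 1) → Site (d + 1) → MKer (d + 1) (Fib d)} {Cs δs CM δM : ℝ}

/-! ## §1 The scaled gauge stencil: decay, block covariance, and its composition with the dressed step kernel -/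

section Stencil

omit [NeZero Lc] in
/-- [folklore] **THE SCALED GAUGE STENCIL DECAYS**: `𝒮_μ = Lc·s_m s_f·σ_j · Σ'_t [t_μ]·S μ t` decays at rate `δs/2` with constant `|Lc s_m s_f σ_j|·Cs·Zl(δs/2)`. -/
theorem decays_gaugeStencil (hS : LocStencil S Cs δs) (hδs : 0 < δs) (sf sm : ℝ) (j : ℕ) (μ : Fin (d + 1)) :
    Decays (fun x z a b => ((Lc : ℝ) * (sm * sf)) * ((((Lc ^ (j + 1) : ℕ) : ℝ)) ^ (d + 1 + 1))⁻¹ *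
        ∑' t : Site (d + 1), (if t μ % (Lc : ℤ) = (Lc : ℤ) - 1 then S μ t x z a b else 0))
      (|((Lc : ℝ) * (sm * sf)) * ((((Lc ^ (j + 1) : ℕ) : ℝ)) ^ (d + 1 + 1))⁻¹| * (Cs * Zl (d + 1) (δs / 2))) (δs / 2) := by
  intro x z a b
  have h := decays_faceStencil (N := Lc) hS hδs μ x z a b
  calc |((Lc : ℝ) * (sm * sf)) * ((((Lc ^ (j + 1) : ℕ) : ℝ)) ^ (d + 1 + 1))⁻¹ * ∑' t : Site (d + 1), (if t μ % (Lc : ℤ) = (Lc : ℤ) - 1 then S μ t x z a b else 0)|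
      = |((Lc : ℝ) * (sm * sf)) * ((((Lc ^ (j + 1) : ℕ) : ℝ)) ^ (d + 1 + 1))⁻¹| * |∑' t : Site (d + 1), (if t μ % (Lc : ℤ) = (Lc : ℤ) - 1 then S μ t x z a b else 0)| :=
        abs_mul _ _
    _ ≤ |((Lc : ℝ) * (sm * sf)) * ((((Lc ^ (j + 1) : ℕ) : ℝ)) ^ (d + 1 + 1))⁻¹| * ((Cs * Zl (d + 1) (δs / 2)) * Real.exp (-(δs / 2) * l1 (x - z))) :=
        mul_le_mul_of_nonneg_left h (abs_nonneg _)
    _ = _ := by ring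

omit [NeZero Lc] in
/-- [folklore] **THE SCALED GAUGE STENCIL IS BLOCK-COVARIANT** for a block-covariant `S`. -/
theorem shiftK_gaugeStencil (hScov : ∀ (κ : Fin (d + 1)) (u t : Site (d + 1)), S κ (u + (Lc : ℤ) • t) = shiftK (-((Lc : ℤ) • t)) (S κ u))
    (sf sm : ℝ) (j : ℕ) (μ : Fin (d + 1)) (v : Site (d + 1)) :
    shiftK (-((Lc : ℤ) • v)) (fun x z a b => ((Lc : ℝ) * (sm * sf)) * ((((Lc ^ (j + 1) : ℕ) : ℝ)) ^ (d + 1 + 1))⁻¹ *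
        ∑' t : Site (d + 1), (if t μ % (Lc : ℤ) = (Lc : ℤ) - 1 then S μ t x z a b else 0)) =
      fun x z a b => ((Lc : ℝ) * (sm * sf)) * ((((Lc ^ (j + 1) : ℕ) : ℝ)) ^ (d + 1 + 1))⁻¹ *
        ∑' t : Site (d + 1), (if t μ % (Lc : ℤ) = (Lc : ℤ) - 1 then S μ t x z a b else 0) := by
  have h := shiftK_faceStencil (N := Lc) hScov μ v
  funext x z a b
  have hx := congrFun (congrFun (congrFun (congrFun h x) z) a) b
  simp only [shiftK] at hx ⊢
  rw [hx]

/-- [folklore] **THE COMPOSITION `X̃♮_j ∘ 𝒮_μ` DECAYS** at a positive rate (the dressed step kernel decays, `decays_comp_mixed`). -/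
theorem exists_decays_comp_dressedStep_gaugeStencil (hLc : 1 ≤ Lc) (hr : r ∈ box (d + 1) Lc) (sf sm : ℝ) (j : ℕ)
    (hS : LocStencil S Cs δs) (hδs : 0 < δs) (μ : Fin (d + 1)) :
    ∃ C m : ℝ, 0 < m ∧ 0 ≤ C ∧ Decays (comp (unitK sf sm (coDressKBmAt (toSite r) Lc (KInvStep (d := d) Lc j)))
      (fun x z a b => ((Lc : ℝ) * (sm * sf)) * ((((Lc ^ (j + 1) : ℕ) : ℝ)) ^ (d + 1 + 1))⁻¹ *
        ∑' t : Site (d + 1), (if t μ % (Lc : ℤ) = (Lc : ℤ) - 1 then S μ t x z a b else 0))) C m := by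
  obtain ⟨δ, C, hδ, hC, hXd⟩ := decays_coDressKBmAt hLc hr (decays_KInvStep (d := d) (Lc := Lc) j)
  have hXu := decays_unitK (sf := sf) (sm := sm) hXd
  have hCX : 0 ≤ max |sf| |sm| * C * max |sf| |sm| := by positivity
  have hG := decays_gaugeStencil (Lc := Lc) hS hδs sf sm j μ
  have hCs : 0 ≤ Cs := (hS 0 0).nonneg (Sum.inl 0)
  set m₀ : ℝ := min δ (δs / 2) with hm₀
  have hm₀0 : 0 < m₀ := lt_min hδ (half_pos hδs)
  have hX1 : Decays (unitK sf sm (coDressKBmAt (toSite r) Lc (KInvStep (d := d) Lc j))) (max |sf| |sm| * C * max |sf| |sm|) (m₀ / 2) :=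
    decays_mono hXu hCX le_rfl (by linarith [min_le_left δ (δs / 2)])
  have hG0 : 0 ≤ |((Lc : ℝ) * (sm * sf)) * ((((Lc ^ (j + 1) : ℕ) : ℝ)) ^ (d + 1 + 1))⁻¹| * (Cs * Zl (d + 1) (δs / 2)) :=
    mul_nonneg (abs_nonneg _) (mul_nonneg hCs (Zl_nonneg (half_pos hδs)))
  have hG1 := decays_mono hG hG0 le_rfl (min_le_right δ (δs / 2))
  have h := decays_comp_mixed hX1 hG1 (by positivity) (by linarith [min_le_left δ (δs / 2)])
  exact ⟨_, m₀ / 2, by positivity, h.nonneg (Sum.inl 0), h⟩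

/-- [folklore] The rows of `X̃♮_j ∘ 𝒮_μ` are summable. -/
theorem summable_row_comp_dressedStep_gaugeStencil (hLc : 1 ≤ Lc) (hr : r ∈ box (d + 1) Lc) (sf sm : ℝ) (j : ℕ)
    (hS : LocStencil S Cs δs) (hδs : 0 < δs) (μ : Fin (d + 1)) (w : Site (d + 1)) (g b : Fib d) :
    Summable fun s' : Site (d + 1) => comp (unitK sf sm (coDressKBmAt (toSite r) Lc (KInvStep (d := d) Lc j)))
      (fun x z a b => ((Lc : ℝ) * (sm * sf)) * ((((Lc ^ (j + 1) : ℕ) : ℝ)) ^ (d + 1 + 1))⁻¹ *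
        ∑' t : Site (d + 1), (if t μ % (Lc : ℤ) = (Lc : ℤ) - 1 then S μ t x z a b else 0)) w s' g b := by
  obtain ⟨C, m, hm, hC, hD⟩ := exists_decays_comp_dressedStep_gaugeStencil hLc hr sf sm j hS hδs μ
  refine Summable.of_norm_bounded ((summable_exp_shift hm w).mul_left C) (fun s' => ?_)
  rw [Real.norm_eq_abs]
  exact hD w s' g b

end Stencil

/-! ## §2 Generic: the bond sum of a centre-tied family inside one and two compositions with a decaying kernel -/

section Generic

variable {N : ℕ} [NeZero N] {K W : MKer (d + 1) (Fib d)} {V : Site (d + 1) → MKer (d + 1) (Fib d)} {C Cv m : ℝ}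

/-- [folklore] **THE BOND SUM INSIDE A LEFT COMPOSITION**: `K` decaying (rate `m > 0`), `V c′` bi-localised at `N•c′` with one constant, `Σ'_{c′} V c′ = W` pointwise ⟹
`HasSum (c′ ↦ (K ∘ V c′) x s′ a g′) ((K ∘ W) x s′ a g′)` — one-sided Fubini over `(s, c′)` with the product majorant `e^{−m|x−s|}·e^{−m|s′−N•c′|}`. -/
theorem hasSum_comp_family_bond (hK : Decays K C m) (hm : 0 < m) (hV : ∀ c', BiLoc (V c') ((N : ℤ) • c') ((N : ℤ) • c') Cv m)
    (hW : ∀ (s s' : Site (d + 1)) (g g' : Fib d), HasSum (fun c' : Site (d + 1) => V c' s s' g g') (W s s' g g'))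
    (x s' : Site (d + 1)) (a g' : Fib d) :
    HasSum (fun c' : Site (d + 1) => comp K (V c') x s' a g') (comp K W x s' a g') := by
  classical
  have hN : 1 ≤ N := Nat.one_le_iff_ne_zero.2 (NeZero.ne N)
  have hC : 0 ≤ C := hK.nonneg (Sum.inl 0)
  have hCv : 0 ≤ Cv := (hV 0).nonneg (Sum.inl 0)
  -- the double family `(s, c′) ↦ Σ_g K x s a g · V c′ s s′ g g′` and its product majorant
  have hGle : ∀ q : Site (d + 1) × Site (d + 1), |∑ g : Fib d, K x q.1 a g * V q.2 q.1 s' g g'| ≤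
      ((Fintype.card (Fib d) : ℝ) * (C * Cv) * Real.exp (-m * l1 (x - q.1))) * Real.exp (-m * l1 (s' - (N : ℤ) • q.2)) := by
    intro q
    refine (Finset.abs_sum_le_sum_abs _ _).trans ?_
    have hterm : ∀ g : Fib d, |K x q.1 a g * V q.2 q.1 s' g g'| ≤ (C * Cv) * Real.exp (-m * l1 (x - q.1)) * Real.exp (-m * l1 (s' - (N : ℤ) • q.2)) := by
      intro g
      rw [abs_mul]
      have h1 := hK x q.1 a g
      have h2 : |V q.2 q.1 s' g g'| ≤ Cv * Real.exp (-m * l1 (s' - (N : ℤ) • q.2)) := by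
        refine (hV q.2 q.1 s' g g').trans (mul_le_mul_of_nonneg_left (Real.exp_le_exp.2 ?_) hCv)
        nlinarith [l1_nonneg (q.1 - (N : ℤ) • q.2), l1_nonneg (s' - (N : ℤ) • q.2), hm.le]
      calc |K x q.1 a g| * |V q.2 q.1 s' g g'| ≤ (C * Real.exp (-m * l1 (x - q.1))) * (Cv * Real.exp (-m * l1 (s' - (N : ℤ) • q.2))) :=
            mul_le_mul h1 h2 (abs_nonneg _) (by positivity)
        _ = _ := by ring
    refine (Finset.sum_le_sum fun g _ => hterm g).trans (le_of_eq ?_)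
    rw [Finset.sum_const, Finset.card_univ, nsmul_eq_mul]
    ring
  have hmaj : Summable fun q : Site (d + 1) × Site (d + 1) =>
      ((Fintype.card (Fib d) : ℝ) * (C * Cv) * Real.exp (-m * l1 (x - q.1))) * Real.exp (-m * l1 (s' - (N : ℤ) • q.2)) :=
    ((summable_exp_shift hm x).mul_left _).mul_of_nonneg (summable_exp_coarse' (d := d) hN hm s') (fun _ => by positivity) (fun _ => (Real.exp_pos _).le)
  have hGs : Summable fun q : Site (d + 1) × Site (d + 1) => ∑ g : Fib d, K x q.1 a g * V q.2 q.1 s' g g' :=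
    Summable.of_norm_bounded hmaj (fun q => by rw [Real.norm_eq_abs]; exact hGle q)
  have hfib : ∀ s : Site (d + 1), HasSum (fun c' : Site (d + 1) => ∑ g : Fib d, K x s a g * V c' s s' g g') (∑ g : Fib d, K x s a g * W s s' g g') :=
    fun s => hasSum_sum fun g _ => (hW s s' g g').mul_left _
  have h := hasSum_fibre_swap hGs hfib
  refine h.congr_fun fun c' => ?_
  rfl

/-- [folklore] **THE BOND SUM INSIDE THE SANDWICH `K ∘ V c′ ∘ K`**: same hypotheses ⟹ `HasSum (c′ ↦ ((K ∘ V c′) ∘ K) x z a b) (((K ∘ W) ∘ K) x z a b)` — the second one-sided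
Fubini over `(s′, c′)`: `K ∘ V c′` is bi-localised at `N•c′` (`biLoc_comp_decays`), the right factor is bounded; product majorant `e^{−(m/4)|x−s′|}·e^{−(m/4)|x−N•c′|}`. -/
theorem hasSum_comp_comp_family_bond (hK : Decays K C m) (hm : 0 < m) (hV : ∀ c', BiLoc (V c') ((N : ℤ) • c') ((N : ℤ) • c') Cv m)
    (hW : ∀ (s s' : Site (d + 1)) (g g' : Fib d), HasSum (fun c' : Site (d + 1) => V c' s s' g g') (W s s' g g'))
    (x z : Site (d + 1)) (a b : Fib d) :
    HasSum (fun c' : Site (d + 1) => comp (comp K (V c')) K x z a b) (comp (comp K W) K x z a b) := by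
  classical
  have hN : 1 ≤ N := Nat.one_le_iff_ne_zero.2 (NeZero.ne N)
  have hC : 0 ≤ C := hK.nonneg (Sum.inl 0)
  have hCv : 0 ≤ Cv := (hV 0).nonneg (Sum.inl 0)
  have hB := fun c' => biLoc_comp_decays hK (hV c') (by positivity : (0 : ℝ) ≤ m / 2) (by linarith : m / 2 < m)
  have hCB : 0 ≤ (Fintype.card (Fib d) : ℝ) * (C * Cv) * Zl (d + 1) (m - m / 2) := (hB 0).nonneg (Sum.inl 0)
  -- the double family `(s′, c′) ↦ Σ_{g′} (K ∘ V c′) x s′ a g′ · K s′ z g′ b` and its product majorant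
  have hGle : ∀ q : Site (d + 1) × Site (d + 1), |∑ g' : Fib d, comp K (V q.2) x q.1 a g' * K q.1 z g' b| ≤
      ((Fintype.card (Fib d) : ℝ) * (((Fintype.card (Fib d) : ℝ) * (C * Cv) * Zl (d + 1) (m - m / 2)) * C) * Real.exp (-(m / 4) * l1 (x - q.1))) *
        Real.exp (-(m / 4) * l1 (x - (N : ℤ) • q.2)) := by
    intro q
    refine (Finset.abs_sum_le_sum_abs _ _).trans ?_
    have hterm : ∀ g' : Fib d, |comp K (V q.2) x q.1 a g' * K q.1 z g' b| ≤
        (((Fintype.card (Fib d) : ℝ) * (C * Cv) * Zl (d + 1) (m - m / 2)) * C) * Real.exp (-(m / 4) * l1 (x - q.1)) * Real.exp (-(m / 4) * l1 (x - (N : ℤ) • q.2)) := by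
      intro g'
      rw [abs_mul]
      have h1 := hB q.2 x q.1 a g'
      have h2 : |K q.1 z g' b| ≤ C := by
        refine (hK q.1 z g' b).trans ?_
        have : Real.exp (-m * l1 (q.1 - z)) ≤ 1 := by
          rw [Real.exp_le_one_iff]; nlinarith [l1_nonneg (q.1 - z), hm.le]
        nlinarith
      have htri := l1_sub_triangle x ((N : ℤ) • q.2) q.1
      rw [ExpKernelCalculus.l1_sub_symm ((N : ℤ) • q.2) q.1] at htri
      have hexp : Real.exp (-(m / 2) * (l1 (x - (N : ℤ) • q.2) + l1 (q.1 - (N : ℤ) • q.2))) ≤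
          Real.exp (-(m / 4) * l1 (x - q.1)) * Real.exp (-(m / 4) * l1 (x - (N : ℤ) • q.2)) := by
        rw [← Real.exp_add, Real.exp_le_exp]
        nlinarith [l1_nonneg (x - (N : ℤ) • q.2), l1_nonneg (q.1 - (N : ℤ) • q.2), hm.le]
      calc |comp K (V q.2) x q.1 a g'| * |K q.1 z g' b|
          ≤ (((Fintype.card (Fib d) : ℝ) * (C * Cv) * Zl (d + 1) (m - m / 2)) * Real.exp (-(m / 2) * (l1 (x - (N : ℤ) • q.2) + l1 (q.1 - (N : ℤ) • q.2)))) * C :=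
            mul_le_mul h1 h2 (abs_nonneg _) (by positivity)
        _ ≤ (((Fintype.card (Fib d) : ℝ) * (C * Cv) * Zl (d + 1) (m - m / 2)) * (Real.exp (-(m / 4) * l1 (x - q.1)) * Real.exp (-(m / 4) * l1 (x - (N : ℤ) • q.2)))) * C :=
            mul_le_mul_of_nonneg_right (mul_le_mul_of_nonneg_left hexp hCB) hC
        _ = _ := by ring
    refine (Finset.sum_le_sum fun g' _ => hterm g').trans (le_of_eq ?_)
    rw [Finset.sum_const, Finset.card_univ, nsmul_eq_mul]
    ring
  have hmaj : Summable fun q : Site (d + 1) × Site (d + 1) =>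
      ((Fintype.card (Fib d) : ℝ) * (((Fintype.card (Fib d) : ℝ) * (C * Cv) * Zl (d + 1) (m - m / 2)) * C) * Real.exp (-(m / 4) * l1 (x - q.1))) *
        Real.exp (-(m / 4) * l1 (x - (N : ℤ) • q.2)) :=
    ((summable_exp_shift (by positivity : 0 < m / 4) x).mul_left _).mul_of_nonneg (summable_exp_coarse' (d := d) hN (by positivity : 0 < m / 4) x)
      (fun _ => by positivity) (fun _ => (Real.exp_pos _).le)
  have hGs : Summable fun q : Site (d + 1) × Site (d + 1) => ∑ g' : Fib d, comp K (V q.2) x q.1 a g' * K q.1 z g' b :=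
    Summable.of_norm_bounded hmaj (fun q => by rw [Real.norm_eq_abs]; exact hGle q)
  have hfib : ∀ s' : Site (d + 1), HasSum (fun c' : Site (d + 1) => ∑ g' : Fib d, comp K (V c') x s' a g' * K s' z g' b)
      (∑ g' : Fib d, comp K W x s' a g' * K s' z g' b) :=
    fun s' => hasSum_sum fun g' _ => (hasSum_comp_family_bond (N := N) hK hm hV hW x s' a g').mul_right _
  have h := hasSum_fibre_swap hGs hfib
  refine h.congr_fun fun c' => ?_
  rfl

end Generic

/-! ## §2b The bond sum of the derivative of the inverse through the dressed step kernel -/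

section BondSum

/-- [folklore] **THE DERIVATIVE OF THE INVERSE SUMMED OVER ITS BOND** (pointwise in the legs): `HasSum (c′ ↦ K2OfK X̃♮_j Lc S M μ c′ x z a b) (−((X̃♮_j ∘ 𝒮_μ) ∘ X̃♮_j) x z a b)`
— §2 at `K = X̃♮_j`, `V c′ = dM X̃♮_j Lc S M μ c′` (an2's `vertexFamily_dM`), `W = 𝒮_μ` (35 `RespGaugeStencil.hasSum_dM_dressedStep_bond`). -/
theorem hasSum_K2OfK_dressedStep_bond (hLc : 1 ≤ Lc) (hr : r ∈ box (d + 1) Lc) (sf sm : ℝ) (j : ℕ)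
    (hS : LocStencil S Cs δs) (hδs : 0 < δs) (hM : VertexFamily M Lc CM δM) (hδM : 0 < δM)
    (μ : Fin (d + 1)) (x z : Site (d + 1)) (a b : Fib d) :
    HasSum (fun c' : Site (d + 1) => K2OfK (unitK sf sm (coDressKBmAt (toSite r) Lc (KInvStep (d := d) Lc j))) Lc S M μ c' x z a b)
      (-(comp (comp (unitK sf sm (coDressKBmAt (toSite r) Lc (KInvStep (d := d) Lc j)))
        (fun x z a b => ((Lc : ℝ) * (sm * sf)) * ((((Lc ^ (j + 1) : ℕ) : ℝ)) ^ (d + 1 + 1))⁻¹ *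
          ∑' t : Site (d + 1), (if t μ % (Lc : ℤ) = (Lc : ℤ) - 1 then S μ t x z a b else 0)))
        (unitK sf sm (coDressKBmAt (toSite r) Lc (KInvStep (d := d) Lc j))) x z a b)) := by
  obtain ⟨δ, C, hδ, hC, hXd⟩ := decays_coDressKBmAt hLc hr (decays_KInvStep (d := d) (Lc := Lc) j)
  have hXu := decays_unitK (sf := sf) (sm := sm) hXd
  have hCX : 0 ≤ max |sf| |sm| * C * max |sf| |sm| := by positivity
  have hCs : 0 ≤ Cs := (hS 0 0).nonneg (Sum.inl 0)
  have hCM : 0 ≤ CM := (hM 0 0).nonneg (Sum.inl 0)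
  have hm : 0 < min (min δ δs) δM := lt_min (lt_min hδ hδs) hδM
  have hX1 : Decays (unitK sf sm (coDressKBmAt (toSite r) Lc (KInvStep (d := d) Lc j))) (max |sf| |sm| * C * max |sf| |sm|) (min (min δ δs) δM) :=
    decays_mono hXu hCX le_rfl ((min_le_left _ _).trans (min_le_left _ _))
  have hS1 := locStencil_mono hS hCs ((min_le_left _ _).trans (min_le_right _ _) : min (min δ δs) δM ≤ δs)
  have hM1 : VertexFamily M Lc CM (min (min δ δs) δM) := fun ρ' w' => biLoc_mono (hM ρ' w') hCM (min_le_right _ _)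
  have hV := vertexFamily_dM (N := Lc) hX1 hCX hS1 hM1 hm le_rfl μ
  have hX2 : Decays (unitK sf sm (coDressKBmAt (toSite r) Lc (KInvStep (d := d) Lc j))) (max |sf| |sm| * C * max |sf| |sm|) (min (min δ δs) δM / 2) :=
    decays_mono hX1 hCX le_rfl (by linarith)
  have h := (hasSum_comp_comp_family_bond (N := Lc) hX2 (half_pos hm) hV
    (fun s s' g g' => hasSum_dM_dressedStep_bond hLc hr sf sm j hS hδs hM hδM μ s s' g g') x z a b).neg
  refine h.congr_fun fun c' => ?_
  rfl

end BondSum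

/-! ## §3 The summed kernel `𝒦_μ = −(X̃ ∘ 𝒮_μ) ∘ X̃`: decay, block covariance, column charges -/

section Kernel

/-- [folklore] **`𝒦_μ` DECAYS** at a positive rate (`decays_comp_mixed` twice). -/
theorem exists_decays_respKernel (hLc : 1 ≤ Lc) (hr : r ∈ box (d + 1) Lc) (sf sm : ℝ) (j : ℕ) (hS : LocStencil S Cs δs) (hδs : 0 < δs) (μ : Fin (d + 1)) :
    ∃ C m : ℝ, 0 < m ∧ 0 ≤ C ∧ Decays (fun x z a b => -(comp (comp (unitK sf sm (coDressKBmAt (toSite r) Lc (KInvStep (d := d) Lc j)))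
        (fun x z a b => ((Lc : ℝ) * (sm * sf)) * ((((Lc ^ (j + 1) : ℕ) : ℝ)) ^ (d + 1 + 1))⁻¹ *
          ∑' t : Site (d + 1), (if t μ % (Lc : ℤ) = (Lc : ℤ) - 1 then S μ t x z a b else 0)))
        (unitK sf sm (coDressKBmAt (toSite r) Lc (KInvStep (d := d) Lc j))) x z a b)) C m := by
  obtain ⟨δ, C, hδ, hC, hXd⟩ := decays_coDressKBmAt hLc hr (decays_KInvStep (d := d) (Lc := Lc) j)
  have hXu := decays_unitK (sf := sf) (sm := sm) hXd
  have hCX : 0 ≤ max |sf| |sm| * C * max |sf| |sm| := by positivity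
  obtain ⟨C₁, m₁, hm₁, hC₁, h1⟩ := exists_decays_comp_dressedStep_gaugeStencil hLc hr sf sm j hS hδs μ
  set m₀ : ℝ := min δ m₁ with hm₀
  have hm₀0 : 0 < m₀ := lt_min hδ hm₁
  have hA : Decays (comp (unitK sf sm (coDressKBmAt (toSite r) Lc (KInvStep (d := d) Lc j)))
      (fun x z a b => ((Lc : ℝ) * (sm * sf)) * ((((Lc ^ (j + 1) : ℕ) : ℝ)) ^ (d + 1 + 1))⁻¹ *
        ∑' t : Site (d + 1), (if t μ % (Lc : ℤ) = (Lc : ℤ) - 1 then S μ t x z a b else 0))) C₁ (m₀ / 2) :=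
    decays_mono h1 hC₁ le_rfl (by linarith [min_le_right δ m₁])
  have hX1 : Decays (unitK sf sm (coDressKBmAt (toSite r) Lc (KInvStep (d := d) Lc j))) (max |sf| |sm| * C * max |sf| |sm|) m₀ :=
    decays_mono hXu hCX le_rfl (min_le_left δ m₁)
  have h := decays_comp_mixed hA hX1 (by positivity) (by linarith)
  refine ⟨_, m₀ / 2, by positivity, h.nonneg (Sum.inl 0), fun x z a b => ?_⟩
  rw [abs_neg]
  exact h x z a b

/-- [folklore] **`𝒦_μ` IS BLOCK-COVARIANT** (`shiftK (−Lc•t) 𝒦_μ = 𝒦_μ`): each factor is (`EEWordReduced.shiftK_dressedStep`, §`shiftK_gaugeStencil`), `comp_shiftK`. -/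
theorem shiftK_respKernel (hLc : 1 ≤ Lc) (sf sm : ℝ) (j : ℕ)
    (hScov : ∀ (κ : Fin (d + 1)) (u t : Site (d + 1)), S κ (u + (Lc : ℤ) • t) = shiftK (-((Lc : ℤ) • t)) (S κ u)) (μ : Fin (d + 1)) (t : Site (d + 1)) :
    shiftK (-((Lc : ℤ) • t)) (fun x z a b => -(comp (comp (unitK sf sm (coDressKBmAt (toSite r) Lc (KInvStep (d := d) Lc j)))
        (fun x z a b => ((Lc : ℝ) * (sm * sf)) * ((((Lc ^ (j + 1) : ℕ) : ℝ)) ^ (d + 1 + 1))⁻¹ *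
          ∑' t : Site (d + 1), (if t μ % (Lc : ℤ) = (Lc : ℤ) - 1 then S μ t x z a b else 0)))
        (unitK sf sm (coDressKBmAt (toSite r) Lc (KInvStep (d := d) Lc j))) x z a b)) =
      fun x z a b => -(comp (comp (unitK sf sm (coDressKBmAt (toSite r) Lc (KInvStep (d := d) Lc j)))
        (fun x z a b => ((Lc : ℝ) * (sm * sf)) * ((((Lc ^ (j + 1) : ℕ) : ℝ)) ^ (d + 1 + 1))⁻¹ *
          ∑' t : Site (d + 1), (if t μ % (Lc : ℤ) = (Lc : ℤ) - 1 then S μ t x z a b else 0)))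
        (unitK sf sm (coDressKBmAt (toSite r) Lc (KInvStep (d := d) Lc j))) x z a b) := by
  have hX := shiftK_dressedStep (d := d) (r := r) hLc sf sm j t
  have hG := shiftK_gaugeStencil (Lc := Lc) hScov sf sm j μ t
  have hc : shiftK (-((Lc : ℤ) • t)) (comp (comp (unitK sf sm (coDressKBmAt (toSite r) Lc (KInvStep (d := d) Lc j)))
        (fun x z a b => ((Lc : ℝ) * (sm * sf)) * ((((Lc ^ (j + 1) : ℕ) : ℝ)) ^ (d + 1 + 1))⁻¹ *
          ∑' t : Site (d + 1), (if t μ % (Lc : ℤ) = (Lc : ℤ) - 1 then S μ t x z a b else 0)))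
        (unitK sf sm (coDressKBmAt (toSite r) Lc (KInvStep (d := d) Lc j)))) =
      comp (comp (unitK sf sm (coDressKBmAt (toSite r) Lc (KInvStep (d := d) Lc j)))
        (fun x z a b => ((Lc : ℝ) * (sm * sf)) * ((((Lc ^ (j + 1) : ℕ) : ℝ)) ^ (d + 1 + 1))⁻¹ *
          ∑' t : Site (d + 1), (if t μ % (Lc : ℤ) = (Lc : ℤ) - 1 then S μ t x z a b else 0)))
        (unitK sf sm (coDressKBmAt (toSite r) Lc (KInvStep (d := d) Lc j))) := by
    rw [← comp_shiftK, ← comp_shiftK, hX, hG]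
  funext x z a b
  have hx := congrFun (congrFun (congrFun (congrFun hc x) z) a) b
  simp only [shiftK] at hx ⊢
  rw [hx]

/-- [folklore] **THE COARSE COLUMN CHARGES OF `𝒦_μ` AGAINST `inr ν`** (in-block root, `1 ≤ Lc`, every `j`, all units; every row `(t, g)`):
`HasSum (u ↦ 𝒦_μ t (Lc•u) g (inr ν)) (−Σ'_{s′} Σ_b (X̃♮_j ∘ 𝒮_μ)(t, s′)(g, b)·chg_ν(b, s′))`, `chg_ν` the dressed column charge of `DressedStepFaceCharges.hasSum_dressedStep_col`
(exit-face indicator on field legs in direction `ν`, zero on multiplier legs) — `RespKernelColumnCharge.hasSum_neg_comp_col_site` with `A = X̃♮_j ∘ 𝒮_μ`. -/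
theorem hasSum_respKernel_col (hLc : 1 ≤ Lc) (hr : r ∈ box (d + 1) Lc) (sf sm : ℝ) (j : ℕ) (hS : LocStencil S Cs δs) (hδs : 0 < δs)
    (μ ν : Fin (d + 1)) (t : Site (d + 1)) (g : Fib d) :
    HasSum (fun u : Site (d + 1) => -(comp (comp (unitK sf sm (coDressKBmAt (toSite r) Lc (KInvStep (d := d) Lc j)))
        (fun x z a b => ((Lc : ℝ) * (sm * sf)) * ((((Lc ^ (j + 1) : ℕ) : ℝ)) ^ (d + 1 + 1))⁻¹ *
          ∑' t : Site (d + 1), (if t μ % (Lc : ℤ) = (Lc : ℤ) - 1 then S μ t x z a b else 0)))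
        (unitK sf sm (coDressKBmAt (toSite r) Lc (KInvStep (d := d) Lc j))) t (((Lc : ℕ) : ℤ) • u) g (Sum.inr ν)))
      (-(∑' s' : Site (d + 1), ∑ b : Fib d,
          comp (unitK sf sm (coDressKBmAt (toSite r) Lc (KInvStep (d := d) Lc j)))
            (fun x z a b => ((Lc : ℝ) * (sm * sf)) * ((((Lc ^ (j + 1) : ℕ) : ℝ)) ^ (d + 1 + 1))⁻¹ *
              ∑' t : Site (d + 1), (if t μ % (Lc : ℤ) = (Lc : ℤ) - 1 then S μ t x z a b else 0)) t s' g b *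
            Sum.elim (fun a : Fin (d + 1) => if s' a % (Lc : ℤ) = (Lc : ℤ) - 1 then ((Lc : ℝ) * (sm * sf)) *
              (if a = ν then ((((Lc ^ (j + 1) : ℕ) : ℝ)) ^ (d + 1 + 1))⁻¹ else 0) else 0) (fun _ => (0 : ℝ)) b)) := by
  obtain ⟨δ, C, hδ, hC, hXd⟩ := decays_coDressKBmAt hLc hr (decays_KInvStep (d := d) (Lc := Lc) j)
  have hXu := decays_unitK (sf := sf) (sm := sm) hXd
  exact hasSum_neg_comp_col_site (N := Lc) hXu hδ ν (fun g' w' => hasSum_dressedStep_col hLc hr sf sm j ν g' w') t g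
    (fun b => summable_row_comp_dressedStep_gaugeStencil hLc hr sf sm j hS hδs μ t g b)

end Kernel

end Summit.QuantumFields.BalabanUV.Beta.GAN24.RespInnerBondKernel

end
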